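import Mathlib
import Summits.Ventures.HodgeRepro.Tier4.Common.AdelicDefs
import Summits.Ventures.HodgeRepro.Tier4.Common.AdelicRTF
import Summits.Ventures.HodgeRepro.Tier4.Common.SettingOfData
import Summits.Ventures.HodgeRepro.Tier4.Line1.CocompactReduction
import Summits.Ventures.HodgeRepro.Tier4.Line1.CentralVanishing
import Summits.Ventures.HodgeRepro.Tier4.Line1.CentralVanishingOrbital

/-!
# Tier4/Line1/CentralVanishingAdelic — LINE L1: the central-character obstruction ON THE DEFINED ADELIC OBJECTS

Blind re-derivation cell `pub-hodge-repro`, Tier 4 «prove the step» (README §9–§10), seat t4-L1-p4 (gen 3; bus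
S13375 / S13414 / S13456).  The generic theorems of `Tier4/Line1/CentralVanishing.lean` (p678622) and
`CentralVanishingOrbital.lean` (p678994) instantiated BY NAME on typer-2's sorry-free `Setting.ofAdelicData W R μ DG
fdG compG compT compT'` (Common/SettingOfData.lean), whose centre is `Z := centre W = torusT W ⊓ torusT' W ⊓
Subgroup.center (GA W)` (Common/AdelicDefs.lean) — the elements of `U(W)(𝔸_k)` central in the whole group and lying in
both tori; `[Countable (rationalPoints W)]` is (I1-e) `rationalPoints_countable` (Line1/CocompactReduction).

WHAT IS PROVED (for ANY pair `chi : torusT W → ℂ`, `chi' : torusT' W → ℂ` that are characters of the setting — not only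
the pair carried by `R`, whose `chi_centre` field is N2 by construction):
* **`orbital_eq_zero_of_ne_on_centre_ofAdelicData`** — if `chi z ≠ chi' z` for one `z ∈ centre W`, every orbital
  term of every `f : GA W → ℂ` on the defined setting is zero (and `J_eq_zero_of_ne_on_centre_ofAdelicData`: so is `J`);
* **`eq_on_centre_of_isolated_ofAdelicData`** — a test function with an isolated orbit carrying a non-zero orbital
  term forces `chi z = chi' z` for every `z ∈ centre W`: N2 on the defined objects is a CONSEQUENCE of the line's
  defined content (`Defined.hiso ∧ Defined.hne`), not a choice;
* **`eq_on_centre_of_orbital_ne_zero_ofAdelicData`** — the same from one non-zero orbital term, without isolation.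

No printed input; nothing here bridges to `P_T4` or to the corner characters of the concrete datum (the seesaw
identification stays displayed).  Nothing here says anything about the status of the Hodge conjecture for CM abelian
varieties, which is NOT proved (HC_CM is NOT proved by anyone in this repository).
-/

set_option autoImplicit false

noncomputable section

namespace Summit.Ventures.HodgeRepro.Tier4.Line1

open MeasureTheory Common

variable {k : Type} [Field k] [NumberField k] (W : PlaneData k)

section OfAdelicData

variable [MeasurableSpace (GA W)] [BorelSpace (GA W)] (R : RTFData W) (μ : Measure (GA W))
  [μ.IsHaarMeasure] [R.μT.IsHaarMeasure] [R.μT'.IsHaarMeasure] (DG : Set (GA W))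
  (fdG : IsFundamentalDomain (rationalPoints W) DG μ) (compG : IsCompact (closure DG))
  (compT : IsCompact (closure R.DT)) (compT' : IsCompact (closure R.DT'))

/-- **`J ≡ 0` on the defined adelic setting when the characters differ on the centre.** -/
theorem J_eq_zero_of_ne_on_centre_ofAdelicData {chi : torusT W → ℂ} {chi' : torusT' W → ℂ}
    (hχ : (Setting.ofAdelicData W R μ DG fdG compG compT compT').IsCharacter chi)
    (hχ' : (Setting.ofAdelicData W R μ DG fdG compG compT compT').IsCharacter' chi')
    {z : GA W} (hz : z ∈ centre W)
    (hne : chi ⟨z, centre_le_torusT W hz⟩ ≠ chi' ⟨z, centre_le_torusT' W hz⟩) (f : GA W → ℂ) :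
    (Setting.ofAdelicData W R μ DG fdG compG compT compT').J chi chi' f = 0 := by
  haveI : Countable (Setting.ofAdelicData W R μ DG fdG compG compT compT').Gk :=
    rationalPoints_countable W
  exact (Setting.ofAdelicData W R μ DG fdG compG compT compT').J_eq_zero_of_ne_on_centre hχ hχ' hz hne f

/-- **Every orbital term vanishes on the defined adelic setting when the characters differ on the centre.** -/
theorem orbital_eq_zero_of_ne_on_centre_ofAdelicData {chi : torusT W → ℂ} {chi' : torusT' W → ℂ}
    (hχ : (Setting.ofAdelicData W R μ DG fdG compG compT compT').IsCharacter chi)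
    (hχ' : (Setting.ofAdelicData W R μ DG fdG compG compT compT').IsCharacter' chi')
    {z : GA W} (hz : z ∈ centre W)
    (hne : chi ⟨z, centre_le_torusT W hz⟩ ≠ chi' ⟨z, centre_le_torusT' W hz⟩)
    (o : (Setting.ofAdelicData W R μ DG fdG compG compT compT').Orbit) (f : GA W → ℂ) :
    (Setting.ofAdelicData W R μ DG fdG compG compT compT').orbital chi chi' o f = 0 := by
  haveI : Countable (Setting.ofAdelicData W R μ DG fdG compG compT compT').Gk :=
    rationalPoints_countable W
  exact (Setting.ofAdelicData W R μ DG fdG compG compT compT').orbital_eq_zero_of_ne_on_centre hχ hχ' hz hne o f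

/-- **N2 on the defined objects from one non-zero orbital term**: `chi = chi'` on `centre W`. -/
theorem eq_on_centre_of_orbital_ne_zero_ofAdelicData {chi : torusT W → ℂ} {chi' : torusT' W → ℂ}
    (hχ : (Setting.ofAdelicData W R μ DG fdG compG compT compT').IsCharacter chi)
    (hχ' : (Setting.ofAdelicData W R μ DG fdG compG compT compT').IsCharacter' chi')
    {o : (Setting.ofAdelicData W R μ DG fdG compG compT compT').Orbit} {f : GA W → ℂ}
    (hne : (Setting.ofAdelicData W R μ DG fdG compG compT compT').orbital chi chi' o f ≠ 0) :
    ∀ z : GA W, ∀ hz : z ∈ centre W, chi ⟨z, centre_le_torusT W hz⟩ = chi' ⟨z, centre_le_torusT' W hz⟩ := by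
  haveI : Countable (Setting.ofAdelicData W R μ DG fdG compG compT compT').Gk :=
    rationalPoints_countable W
  exact (Setting.ofAdelicData W R μ DG fdG compG compT compT').centralMatch_of_orbital_ne_zero hχ hχ' hne

/-- **N2 on the defined objects from the line's DEFINED content**: a test function whose geometric support is one
rational double coset with a non-zero orbital term (`Defined.hiso ∧ Defined.hne`) forces `chi = chi'` on
`centre W`. -/
theorem eq_on_centre_of_isolated_ofAdelicData {chi : torusT W → ℂ} {chi' : torusT' W → ℂ}
    (hχ : (Setting.ofAdelicData W R μ DG fdG compG compT compT').IsCharacter chi)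
    (hχ' : (Setting.ofAdelicData W R μ DG fdG compG compT compT').IsCharacter' chi')
    {f : GA W → ℂ} (hf : RTF.IsTest f) {o₀ : (Setting.ofAdelicData W R μ DG fdG compG compT compT').Orbit}
    (hiso : (Setting.ofAdelicData W R μ DG fdG compG compT compT').geoSupport f = {o₀})
    (hne : (Setting.ofAdelicData W R μ DG fdG compG compT compT').orbital chi chi' o₀ f ≠ 0) :
    ∀ z : GA W, ∀ hz : z ∈ centre W, chi ⟨z, centre_le_torusT W hz⟩ = chi' ⟨z, centre_le_torusT' W hz⟩ := by
  haveI : Countable (Setting.ofAdelicData W R μ DG fdG compG compT compT').Gk :=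
    rationalPoints_countable W
  exact (Setting.ofAdelicData W R μ DG fdG compG compT compT').centralMatch_of_isolated hχ hχ' hf hiso hne

end OfAdelicData

end Summit.Ventures.HodgeRepro.Tier4.Line1

end
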